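import Mathlib
import Summits.Ventures.YMGap.FlowData.RitzDeflationCertificate
import HarnessLib

/-!
# The build-rounding model of the lineage-A block certificate, II: the symmetrised block and the Schur/Weyl door

HONEST FRAMING: finite-dimensional real linear algebra (entries, row sums) plus one hand-over to the tree's door
`RitzDeflation.abs_eigenvalues₀_sub_le_of_entrywise` (`‖(G − M) i j‖ ≤ N i j`, row AND column sums of `N` `≤ errG`
⇒ `|λ↓ᵢ(G) − λ↓ᵢ(M)| ≤ errG`).  The Y3 FLOW-DATA lineage-A engine `sntm` (`kit_build.py:cert_eigs`) has an entrywise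
model `|M₀ − G| ≤ κ·A` for the UNSYMMETRISED float block `M₀` (`A = Mabs`, `κ = c·u`; typed from the standard model in
the sibling file `FlowData/GalerkinRoundingModel.lean`) and diagonalises the SYMMETRISED block `M = (M₀ + M₀ᵀ)/2`.
Proved here: `M` is symmetric; `|M − G| ≤ κ·(A + Aᵀ)/2` entrywise — a SYMMETRIC dominating matrix, so the door's
column-sum hypothesis IS its row-sum hypothesis; hence `|λ↓ᵢ(G) − λ↓ᵢ(M)| ≤ errG` for every
`errG ≥ κ · Σⱼ (A i j + A j i)/2` (all `i`); with a row-sum bound `R` and a column-sum bound `C` of `A`,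
`errG = κ(R + C)/2` is admissible — `κ·‖A‖_∞` alone (the engine's printed `errG`) is the case `C ≤ R`; the engine's
`Mabs` is symmetric to ≤ 1.2 % on its regression blocks and its constant carries a ×4 margin, so no row moves; the
statement here is what an `errG` must dominate.  No lattice number, continuum or Clay statement is touched.

Namespace `Summit.Ventures.YMGap.FlowData.GalerkinRounding`.

## References
* [HornJohnson2013] R. A. Horn, C. R. Johnson, *Matrix Analysis*, 2nd ed., CUP 2013 — Thm 4.3.1 (Weyl), 5.6.P21
  (the Schur test `‖N‖₂² ≤ ‖N‖₁‖N‖_∞`).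
* [Higham2002ASNA] N. J. Higham, *Accuracy and Stability of Numerical Algorithms*, 2nd ed., SIAM 2002 — §3.5
  (`|ΔA| ≤ γ|A|` entrywise models).
-/

noncomputable section

open Matrix Finset

namespace Summit.Ventures.YMGap.FlowData

namespace GalerkinRounding


/-! ### Symmetrisation and the hand-over to the Schur/Weyl door -/

section Matrices

variable {m : Type*} [Fintype m] [DecidableEq m]

omit [Fintype m] [DecidableEq m] in
/-- The symmetrised float block `(M₀ + M₀ᵀ)/2` is symmetric (what `numpy.linalg.eigh` is given).
[cite: HornJohnson2013, Thm 4.3.1] -/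
theorem isHermitian_symmetrise (M₀ : Matrix m m ℝ) : ((2 : ℝ)⁻¹ • (M₀ + M₀ᵀ)).IsHermitian := by
  rw [Matrix.isHermitian_iff_isSymm]
  exact (Matrix.isSymm_add_transpose_self M₀).smul _

omit [Fintype m] [DecidableEq m] in
/-- **Symmetrisation halves and transposes the dominating matrix.** If `G` is symmetric and the unsymmetrised float
block obeys `|M₀ − G| ≤ κ·A` entrywise, then the symmetrised block obeys `|(M₀+M₀ᵀ)/2 − G| ≤ κ·(A + Aᵀ)/2`
entrywise. [cite: HornJohnson2013, Thm 4.3.1] -/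
theorem abs_symmetrise_sub_le {G M₀ A : Matrix m m ℝ} (hG : Gᵀ = G) {κ : ℝ}
    (hdom : ∀ i j, |M₀ i j - G i j| ≤ κ * A i j) (i j : m) :
    |((2 : ℝ)⁻¹ • (M₀ + M₀ᵀ)) i j - G i j| ≤ κ * ((A i j + A j i) / 2) := by
  have hGji : G j i = G i j := by
    have := congrFun (congrFun hG i) j
    simpa [Matrix.transpose_apply] using this
  have e : ((2 : ℝ)⁻¹ • (M₀ + M₀ᵀ)) i j - G i j = ((M₀ i j - G i j) + (M₀ j i - G j i)) / 2 := by
    simp [Matrix.smul_apply, Matrix.add_apply, Matrix.transpose_apply, hGji]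
    ring
  rw [e, abs_div, abs_two]
  have := add_le_add (hdom i j) (hdom j i)
  calc |(M₀ i j - G i j) + (M₀ j i - G j i)| / 2 ≤ (κ * A i j + κ * A j i) / 2 := by
        gcongr; exact (abs_add_le _ _).trans this
    _ = κ * ((A i j + A j i) / 2) := by ring

omit [DecidableEq m] in
/-- Row sums of the symmetrised dominating matrix from a row-sum bound `R` and a column-sum bound `C` of `A`:
`Σⱼ (A i j + A j i)/2 ≤ (R + C)/2` — so `κ·(‖A‖_∞ + ‖A‖₁)/2` is always an admissible `errG`, and `κ·‖A‖_∞` is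
exactly when `C ≤ R`. [cite: HornJohnson2013, 5.6.P21] -/
theorem sum_half_add_transpose_le {A : Matrix m m ℝ} {R C : ℝ} (hrow : ∀ i, ∑ j, A i j ≤ R)
    (hcol : ∀ j, ∑ i, A i j ≤ C) (i : m) : ∑ j, (A i j + A j i) / 2 ≤ (R + C) / 2 := by
  have h1 : ∑ j, (A i j + A j i) / 2 = (∑ j, A i j + ∑ j, A j i) / 2 := by
    rw [← Finset.sum_add_distrib, Finset.sum_div]
  rw [h1]
  gcongr
  · exact hrow i
  · exact hcol i

/-- **Hand-over, general dominating matrix.** `G`, `M` symmetric, `|G − M| ≤ κ·A` entrywise with `κ ≥ 0`-scaled row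
and column sums `≤ errG` ⇒ `|λ↓ᵢ(G) − λ↓ᵢ(M)| ≤ errG` (the tree's Schur/Weyl door with `N = κ·A`).
[cite: HornJohnson2013, Thm 4.3.1; 5.6.P21] -/
theorem abs_eigenvalues₀_sub_le_of_scaled {G M : Matrix m m ℝ} (hG : G.IsHermitian) (hM : M.IsHermitian)
    (A : Matrix m m ℝ) {κ errG : ℝ} (hdom : ∀ i j, |G i j - M i j| ≤ κ * A i j)
    (hrow : ∀ i, κ * ∑ j, A i j ≤ errG) (hcol : ∀ j, κ * ∑ i, A i j ≤ errG) (k : Fin (Fintype.card m)) :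
    |hG.eigenvalues₀ k - hM.eigenvalues₀ k| ≤ errG := by
  refine RitzDeflation.abs_eigenvalues₀_sub_le_of_entrywise hG hM (fun i j => κ * A i j) (fun i j => ?_)
    (fun i => by rw [← Finset.mul_sum]; exact hrow i) (fun j => by rw [← Finset.mul_sum]; exact hcol j) k
  rw [Real.norm_eq_abs, Matrix.sub_apply]
  exact hdom i j

/-- **Hand-over for the symmetrised block (the engine's case).** `G` symmetric (the exact Galerkin block), `M₀` the
unsymmetrised float block with `|M₀ − G| ≤ κ·A` entrywise, `M = (M₀+M₀ᵀ)/2`; then for every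
`errG ≥ κ·Σⱼ (A i j + A j i)/2` (all `i`): `|λ↓ᵢ(G) − λ↓ᵢ(M)| ≤ errG`.  The dominating matrix `κ(A+Aᵀ)/2` is symmetric,
so no separate column-sum hypothesis is needed. [cite: HornJohnson2013, Thm 4.3.1; 5.6.P21] -/
theorem abs_eigenvalues₀_sub_le_of_symmetrised {G M₀ : Matrix m m ℝ} (hG : G.IsHermitian) (A : Matrix m m ℝ)
    {κ errG : ℝ} (hdom : ∀ i j, |M₀ i j - G i j| ≤ κ * A i j)
    (herr : ∀ i, κ * ∑ j, (A i j + A j i) / 2 ≤ errG) (k : Fin (Fintype.card m)) :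
    |hG.eigenvalues₀ k - (isHermitian_symmetrise M₀).eigenvalues₀ k| ≤ errG := by
  have hGt : Gᵀ = G := by
    have h := hG
    rw [Matrix.isHermitian_iff_isSymm] at h
    exact h
  refine abs_eigenvalues₀_sub_le_of_scaled hG (isHermitian_symmetrise M₀) (fun i j => (A i j + A j i) / 2)
    (fun i j => ?_) herr (fun j => ?_) k
  · rw [abs_sub_comm]
    exact abs_symmetrise_sub_le hGt hdom i j
  · have : ∑ i, (A i j + A j i) / 2 = ∑ i, (A j i + A i j) / 2 :=
      Finset.sum_congr rfl fun i _ => by rw [add_comm]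
    rw [this]
    exact herr j

/-- The two-norm-style corollary: with a row-sum bound `R` and a column-sum bound `C` of the float absolute
accumulation `A` and `κ ≥ 0`, `errG = κ·(R + C)/2` is admissible for the symmetrised block.
[cite: HornJohnson2013, Thm 4.3.1; 5.6.P21] -/
theorem abs_eigenvalues₀_sub_le_of_rowcol {G M₀ : Matrix m m ℝ} (hG : G.IsHermitian) (A : Matrix m m ℝ)
    {κ R C : ℝ} (hκ : 0 ≤ κ) (hdom : ∀ i j, |M₀ i j - G i j| ≤ κ * A i j) (hrow : ∀ i, ∑ j, A i j ≤ R)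
    (hcol : ∀ j, ∑ i, A i j ≤ C) (k : Fin (Fintype.card m)) :
    |hG.eigenvalues₀ k - (isHermitian_symmetrise M₀).eigenvalues₀ k| ≤ κ * ((R + C) / 2) :=
  abs_eigenvalues₀_sub_le_of_symmetrised hG A hdom
    (fun i => mul_le_mul_of_nonneg_left (sum_half_add_transpose_le hrow hcol i) hκ) k

end Matrices

end GalerkinRounding

end Summit.Ventures.YMGap.FlowData

end
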